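import Literature.Geometry.Riemannian.CylinderChartComponents
import Literature.Geometry.Lorentzian.CoordTensorNormLower
import HarnessLib

/-!
# Positivity of the `C`-normal Taylor polynomial slices (Bär–Hanke 2023, §3, Thm. 27)

Topic `Literature/Geometry/Riemannian`. A brick (K5e-2 of the notes) of the proof of the named
fact `Literature.Geometry.Riemannian.BarHanke2023_thm27_umbilicNormalForm`. The deformed cylinder
of `CylinderNormalFormMetric.lean` is Riemannian as soon as the horizontal forms
`P_t(z) = (1 − κ) g₀(z) + e ġ₀(z)` (`κ = Ct² + 2μ(z)χ(t)`, `e = t − χ(t)`) are positive definite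
wherever the cutoff `a(t)` is nonzero, i.e. for `|t| < ε` small. This file provides the
quantitative version read in a chart:

* `norm_sq_le_sharpAt_sq_mul` — ellipticity of a positive definite form from its inverse:
  `‖a‖² ≤ ‖♯_P‖² ‖P‖ P(a, a)` (Cauchy–Schwarz);
* `sliceDeriv_chart_apply` — the chart components of `B = ġ₀` are `Ḟ(·, 0)`;
* `taylorSlice_pos` — if `‖♯_{F(·,0)}(p)‖, ‖F(p,0)‖, ‖Ḟ(p,0)‖ ≤ b` and `|κ| + |e| b⁴ < 1` then
  `(1 − κ) g₀(v, v) + e B(v, v) > 0` for `v = dψ⁻¹ a ≠ 0`.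

Everything is proved; no definitions, no named facts (D-0026).

## References

* C. Bär, B. Hanke, *Boundary conditions for scalar curvature*, arXiv:2012.09127, §3, (15) and
  proof of Thm. 27. [BarHanke2023]
-/

noncomputable section

set_option maxSynthPendingDepth 3

open Bundle Set Filter Function Metric TopologicalSpace
open scoped Manifold ContDiff Topology

namespace Literature.Geometry.Riemannian

open Literature.Geometry.Lorentzian
open Literature.Geometry.Lorentzian.PseudoRiemannianMetric
open Literature.Geometry.Lorentzian.MetricCoord

section Ellipticity

variable {E : Type*} [NormedAddCommGroup E] [NormedSpace ℝ E]

/-- **Ellipticity from the inverse**: for a symmetric positive semidefinite invertible form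
`P = A x`, `‖a‖² ≤ ‖♯_P‖² ‖P‖ P(a,a)` (write `a = ♯(P a)` and bound `‖P a‖² ≤ P(a,a) ‖P‖` by
Cauchy–Schwarz). [folklore] -/
theorem norm_sq_le_sharpAt_sq_mul (A : E → E →L[ℝ] E →L[ℝ] ℝ) (x : E)
    (hinv : (A x).IsInvertible) (hs : ∀ v w, A x v w = A x w v) (hpos : ∀ v, 0 ≤ A x v v)
    (a : E) : ‖a‖ ^ 2 ≤ ‖sharpAt A x‖ ^ 2 * ‖A x‖ * A x a a := by
  have h1 : ‖a‖ ≤ ‖sharpAt A x‖ * ‖A x a‖ := by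
    conv_lhs => rw [← sharpAt_apply hinv a]
    exact ContinuousLinearMap.le_opNorm _ _
  have h2 : ‖A x a‖ ≤ Real.sqrt (A x a a * ‖A x‖) := by
    refine ContinuousLinearMap.opNorm_le_bound _ (Real.sqrt_nonneg _) fun w ↦ ?_
    have hcs := sq_apply_le_mul_of_nonneg (A x) hs hpos a w
    have hww : A x w w ≤ ‖A x‖ * ‖w‖ ^ 2 := by
      calc A x w w ≤ ‖A x w w‖ := Real.le_norm_self _
        _ ≤ ‖A x‖ * ‖w‖ * ‖w‖ := ContinuousLinearMap.le_opNorm₂ _ _ _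
        _ = ‖A x‖ * ‖w‖ ^ 2 := by ring
    have hsq : (A x a w) ^ 2 ≤ (A x a a * ‖A x‖) * ‖w‖ ^ 2 := by
      calc (A x a w) ^ 2 ≤ A x a a * A x w w := hcs
        _ ≤ A x a a * (‖A x‖ * ‖w‖ ^ 2) := by gcongr; exact hpos a
        _ = _ := by ring
    have h := Real.abs_le_sqrt hsq
    rw [Real.sqrt_mul (mul_nonneg (hpos a) (norm_nonneg _)), Real.sqrt_sq (norm_nonneg _)] at h
    rw [Real.norm_eq_abs]
    exact h
  have h3 : ‖A x a‖ ^ 2 ≤ A x a a * ‖A x‖ := by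
    calc ‖A x a‖ ^ 2 ≤ (Real.sqrt (A x a a * ‖A x‖)) ^ 2 := by gcongr
      _ = A x a a * ‖A x‖ := Real.sq_sqrt (mul_nonneg (hpos a) (norm_nonneg _))
  calc ‖a‖ ^ 2 ≤ (‖sharpAt A x‖ * ‖A x a‖) ^ 2 := by gcongr
    _ = ‖sharpAt A x‖ ^ 2 * ‖A x a‖ ^ 2 := by ring
    _ ≤ ‖sharpAt A x‖ ^ 2 * (A x a a * ‖A x‖) := by gcongr
    _ = _ := by ring

end Ellipticity

variable {E' : Type*} [NormedAddCommGroup E'] [InnerProductSpace ℝ E'] [FiniteDimensional ℝ E']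
  {N : Type*} [TopologicalSpace N] [ChartedSpace E' N] [IsManifold 𝓘(ℝ, E') ∞ N]
  (G : PseudoRiemannianMetric (𝓘(ℝ, E').prod 𝓘(ℝ, ℝ)) ∞ (E' × ℝ)
    (TangentSpace (𝓘(ℝ, E').prod 𝓘(ℝ, ℝ)) : N × ℝ → Type _))
  {ψ : OpenPartialHomeomorph N E'}
  (hG : G.IsRiemannian)
  (hψ : ψ ∈ IsManifold.maximalAtlas 𝓘(ℝ, E') ∞ N)
  (F : E' → ℝ → E' →L[ℝ] E' →L[ℝ] ℝ)
  (hF : ∀ (y : E') (s : ℝ), F y s = MaxAtlasChart.metricRepr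
    (G.inducedMetric (fun x : N ↦ ((x, s) : N × ℝ))
      (contMDiff_pullbackBilin_holds (I := 𝓘(ℝ, E').prod 𝓘(ℝ, ℝ)) (M := N × ℝ)
        (I' := 𝓘(ℝ, E')) (N := N))
      (isSpacelikeImmersion_cylSlice G hG s)) hψ y)

include hF

/-- **The chart components of `B = ġ₀` are `Ḟ(·, 0)`**: if
`∂_t|₀ G_{(z,t)}((v,0),(w,0)) = B(z)(v,w)` then
`B(ψ⁻¹p)(dψ⁻¹a, dψ⁻¹a') = Ḟ(p, 0)(a, a')`. [cite: BarHanke2023, §3, (7)] -/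
theorem sliceDeriv_chart_apply
    {B : Π z : N, TangentSpace 𝓘(ℝ, E') z →L[ℝ] TangentSpace 𝓘(ℝ, E') z →L[ℝ] ℝ}
    (hBd : ∀ (z : N) (v w : E'),
      HasDerivAt (fun t : ℝ ↦ G.val (z, t) ((v, 0) : TangentSpace (𝓘(ℝ, E').prod 𝓘(ℝ, ℝ)) (z, t))
        ((w, 0) : TangentSpace (𝓘(ℝ, E').prod 𝓘(ℝ, ℝ)) (z, t))) (B z v w) 0)
    (p : MaxAtlasChart.target ψ) (a a' : E') :
    B (ψ.symm p) (mfderiv 𝓘(ℝ, E') 𝓘(ℝ, E') ψ.symm (p : E') a)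
      (mfderiv 𝓘(ℝ, E') 𝓘(ℝ, E') ψ.symm (p : E') a') = deriv (fun σ : ℝ ↦ F p σ) 0 a a' := by
  have h1 := hBd (ψ.symm p) (mfderiv 𝓘(ℝ, E') 𝓘(ℝ, E') ψ.symm (p : E') a)
    (mfderiv 𝓘(ℝ, E') 𝓘(ℝ, E') ψ.symm (p : E') a')
  have h2 := hasDerivAt_cylComponents_apply₂ G hG hψ F hF p 0 a a'
  have hfun : (fun σ : ℝ ↦ F p σ a a') = fun σ : ℝ ↦ G.val (ψ.symm p, σ)
      ((mfderiv 𝓘(ℝ, E') 𝓘(ℝ, E') ψ.symm (p : E') a, 0) :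
        TangentSpace (𝓘(ℝ, E').prod 𝓘(ℝ, ℝ)) (ψ.symm p, σ))
      ((mfderiv 𝓘(ℝ, E') 𝓘(ℝ, E') ψ.symm (p : E') a', 0) :
        TangentSpace (𝓘(ℝ, E').prod 𝓘(ℝ, ℝ)) (ψ.symm p, σ)) :=
    funext fun σ ↦ cylComponents_apply G hG hψ F hF p σ a a'
  rw [hfun] at h2
  exact h1.unique h2

/-- **Positivity of the Taylor-polynomial slices** (the deformed cylinder is Riemannian): if
`‖♯_{F(·,0)}(p)‖, ‖F(p,0)‖, ‖Ḟ(p,0)‖ ≤ b` and `|κ| + |e| b⁴ < 1`, then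
`(1 − κ) g₀(v,v) + e B(v,v) > 0` for every `v = dψ⁻¹ a` with `a ≠ 0`.
[cite: BarHanke2023, §3, (15) and proof of Thm. 27] -/
theorem taylorSlice_pos
    {B : Π z : N, TangentSpace 𝓘(ℝ, E') z →L[ℝ] TangentSpace 𝓘(ℝ, E') z →L[ℝ] ℝ}
    (hBd : ∀ (z : N) (v w : E'),
      HasDerivAt (fun t : ℝ ↦ G.val (z, t) ((v, 0) : TangentSpace (𝓘(ℝ, E').prod 𝓘(ℝ, ℝ)) (z, t))
        ((w, 0) : TangentSpace (𝓘(ℝ, E').prod 𝓘(ℝ, ℝ)) (z, t))) (B z v w) 0)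
    (p : MaxAtlasChart.target ψ) {b κ e : ℝ} (hb : 1 ≤ b)
    (hs : ‖sharpAt (fun y ↦ F y 0) p‖ ≤ b) (hF00 : ‖F p 0‖ ≤ b)
    (hFd0 : ‖deriv (fun σ : ℝ ↦ F p σ) 0‖ ≤ b) (hκe : |κ| + |e| * b ^ 4 < 1)
    {a : E'} (ha : a ≠ 0) :
    0 < (1 - κ) * G.val (ψ.symm p, (0 : ℝ))
        ((mfderiv 𝓘(ℝ, E') 𝓘(ℝ, E') ψ.symm (p : E') a, 0) :
          TangentSpace (𝓘(ℝ, E').prod 𝓘(ℝ, ℝ)) (ψ.symm p, (0 : ℝ)))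
        ((mfderiv 𝓘(ℝ, E') 𝓘(ℝ, E') ψ.symm (p : E') a, 0) :
          TangentSpace (𝓘(ℝ, E').prod 𝓘(ℝ, ℝ)) (ψ.symm p, (0 : ℝ))) +
      e * B (ψ.symm p) (mfderiv 𝓘(ℝ, E') 𝓘(ℝ, E') ψ.symm (p : E') a)
        (mfderiv 𝓘(ℝ, E') 𝓘(ℝ, E') ψ.symm (p : E') a) := by
  rw [← cylComponents_apply G hG hψ F hF p 0 a a, sliceDeriv_chart_apply G hG hψ F hF hBd p a a]
  -- the slice `F(·, 0)` is a Riemannian metric family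
  have hm : IsMetricOn (fun y ↦ F y 0) ψ.target := by
    have hfun : (fun y ↦ F y 0) = MaxAtlasChart.metricRepr
        (G.inducedMetric (fun x : N ↦ ((x, (0 : ℝ)) : N × ℝ))
          (contMDiff_pullbackBilin_holds (I := 𝓘(ℝ, E').prod 𝓘(ℝ, ℝ)) (M := N × ℝ)
            (I' := 𝓘(ℝ, E')) (N := N))
          (isSpacelikeImmersion_cylSlice G hG 0)) hψ := funext fun y ↦ hF y 0
    rw [hfun]
    exact MaxAtlasChart.isMetricOn_metricRepr _ hψ
  have hx : (p : E') ∈ ψ.target := p.2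
  have hsymm : ∀ v w : E', F p 0 v w = F p 0 w v := hm.symm p hx
  have hposdef' : ∀ v : E', v ≠ 0 → 0 < F p 0 v v := fun v hv ↦ by
    rw [cylComponents_apply G hG hψ F hF p 0 v v]
    refine hG _ _ ?_
    -- `dψ⁻¹ v ≠ 0` as `dψ⁻¹` is injective
    intro h0
    apply hv
    have hinj := (MaxAtlasChart.mdifferentiable_chart hψ).symm.mfderiv_injective
      (I := 𝓘(ℝ, E')) (I' := 𝓘(ℝ, E')) p.2
    have h0' : mfderiv 𝓘(ℝ, E') 𝓘(ℝ, E') ψ.symm (p : E') v = 0 := congrArg Prod.fst h0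
    exact hinj (h0'.trans (map_zero _).symm)
  have hpos : ∀ v : E', 0 ≤ F p 0 v v := fun v ↦ by
    by_cases hv : v = 0
    · rw [hv, map_zero]
    · exact (hposdef' v hv).le
  have hposdef : 0 < F p 0 a a := hposdef' a ha
  -- ellipticity and the bound on `Ḟ(p,0)(a,a)`
  have hb0 : 0 ≤ b := zero_le_one.trans hb
  have hell := norm_sq_le_sharpAt_sq_mul (fun y ↦ F y 0) (p : E') (hm.isInvertible p hx) hsymm hpos a
  have hell' : ‖a‖ ^ 2 ≤ b ^ 3 * F p 0 a a := by
    calc ‖a‖ ^ 2 ≤ ‖sharpAt (fun y ↦ F y 0) p‖ ^ 2 * ‖F p 0‖ * F p 0 a a := hell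
      _ ≤ b ^ 2 * b * F p 0 a a := by gcongr
      _ = b ^ 3 * F p 0 a a := by ring
  have hB : |deriv (fun σ : ℝ ↦ F p σ) 0 a a| ≤ b ^ 4 * F p 0 a a := by
    calc |deriv (fun σ : ℝ ↦ F p σ) 0 a a| = ‖deriv (fun σ : ℝ ↦ F p σ) 0 a a‖ := (Real.norm_eq_abs _).symm
      _ ≤ ‖deriv (fun σ : ℝ ↦ F p σ) 0‖ * ‖a‖ * ‖a‖ := ContinuousLinearMap.le_opNorm₂ _ _ _
      _ ≤ b * ‖a‖ * ‖a‖ := by gcongr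
      _ = b * ‖a‖ ^ 2 := by ring
      _ ≤ b * (b ^ 3 * F p 0 a a) := by gcongr
      _ = b ^ 4 * F p 0 a a := by ring
  -- conclusion
  have h1 : (1 - |κ|) * F p 0 a a ≤ (1 - κ) * F p 0 a a := by
    nlinarith [mul_nonneg (sub_nonneg.2 (le_abs_self κ)) hposdef.le]
  have h' : |e * deriv (fun σ : ℝ ↦ F p σ) 0 a a| ≤ |e| * (b ^ 4 * F p 0 a a) := by
    rw [abs_mul]; gcongr
  have h2 := (abs_le.1 h').1
  have hprod : 0 < (1 - (|κ| + |e| * b ^ 4)) * F p 0 a a := mul_pos (by linarith) hposdef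
  nlinarith [h1, h2, hprod]

end Literature.Geometry.Riemannian

end
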